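import Literature.MathematicalPhysics.KineticTheory.HierarchyEnergyTruncation
import Literature.MathematicalPhysics.KineticTheory.TaggedBoltzmannHierarchy
import HarnessLib

/-!
# The tagged Boltzmann hierarchy as a two-time mild solution with its a priori bound
(Bodineau–Gallagher–Saint-Raymond, Invent. Math. 203 (2016) = arXiv:1305.3397v2, §3.3 Remark 3.4,
§4.3 (4.7); trunk T-KINETIC, topic MathematicalPhysics/KineticTheory; layer A2 of the bottom-up
proof plan of the named fact `bgsr_theorem22` / fact (c) `bodineau_gallagher_saintRaymond_linear`
recorded in `TaggedSphereLinearBoltzmann`: it feeds BGSR's Boltzmann family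
`g_α^{(s)} = φ_α ⊗ M_β^{⊗s}` into the abstract pruning machinery of `HierarchyDuhamelBlocks` (N4a)
and `HierarchyPruningEstimates` (N4b).)

The abstract layers N4a/N4b are stated for a `HierarchyModel` `M` and a *two-time* mild solution
`F` (`HierarchyModel.IsMildSolution M T F`: `F^{(s)}(t'+h) = S_s(h) F^{(s)}(t') +
∫_0^h S_s(h-τ) C_s F^{(s+1)}(t'+τ) dτ` from every intermediate time `t'`, each level in the
Lanford class `IsNiceT`), together with an a priori bound `|F^{(k)}(τ, Z_k)| ≤ R₀ C₀^k e^{-β H_k}`.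
For the Boltzmann hierarchy of BGSR (the instance `boltzmannModel G hG α` of N4a, collision
operator `α C⁰_{s,s+1}`) and the family `g_α^{(s)}(t, Z_s) = φ_α(t, z₀) M_β^{⊗s}(V_s)`
(`bgsrHierarchyFamily`, `TaggedBoltzmannHierarchy`; `φ_α` the collision-series solution of (1.3))
this file PROVES both inputs:

* `HierarchyModel.isMildSolution_of_duhamel_zero` — for any model whose flows form a group on
  the whole phase space (free flight does; the hard-sphere flows do not), a family in the Lanford
  class satisfying the one-time mild hierarchy from time `0` is a two-time mild solution (restart
  the Duhamel formula: group law of the transports, additivity and translation of the time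
  integral).
* `LinearBoltzmannData.isNiceT_bgsrHierarchyFamily`, `LinearBoltzmannData.abs_bgsrHierarchyFamily_le`
  — **the a priori bound (4.7)** `‖g_α^{(k)}(t)‖_{0,k,β} ≤ (β/2π)^{kd/2} ‖ρ⁰‖_{L^∞}`: here
  `|g^{(k)}(t, Z_k)| ≤ R ((β/2π)^{d/2})^k e^{-β H_k(Z_k)}` for all `t`, from the maximum principle
  `0 ≤ φ_α ≤ R` (`LinearBoltzmannData.linearBoltzmannSeries_mem`, BGSR Remark 3.5) and
  `M_β^{⊗k} = (β/2π)^{kd/2} e^{-β H_k}` (`tensorPow_maxwellianBeta`); joint measurability from the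
  joint continuity of `φ_α` (`LinearBoltzmannData.continuous_linearBoltzmannSeries`).
* `LinearBoltzmannData.isMildSolution_bgsrHierarchyFamily` — **`g_α` is a two-time mild solution
  of `boltzmannModel G hG α` on every `[0, T]`** (Remark 3.4 in the form N4a/N4b consume), from the
  one-time form `LinearBoltzmannData.bgsrHierarchyFamily_duhamel` of `TaggedBoltzmannHierarchy`;
  `isMildSolution_bgsrHierarchyFamily_torus` is BGSR's setting (`T^d`, datum `ρ⁰(x)`).
* `LinearBoltzmannData.abs_bgsrHierarchyFamily_sub_blockComp_le` — **BGSR Proposition 4.3 for the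
  Boltzmann hierarchy**: the pruned expansion (4.11)–(4.12) of `g_α = g_α^{(1,K)} + R_α^{0,K}` has
  `|R_α^{0,K}(Kh)(z)| ≤ 2 γ^A max(R,1) max(1,(β/2π)^{d/2})` as soon as the step satisfies
  `max(1,(β/2π)^{d/2}) c_R h ≤ γ/e²` (`c_R = pruneConst (boltzmannModel G hG α) β ∝ |α|`), by N4b's
  `HierarchyModel.IsMildSolution.abs_sub_blockComp_le`; `…_torus` on `T^d`.

The BBGKY counterpart (the marginals of the hard-sphere dynamics as a two-time mild solution of
`bbgkyModel`, BGSR (3.3)–(3.6)) is NOT here: it is the hard-sphere BBGKY hierarchy itself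
(GSRT 2013 Part II), a separate layer.

## Design choices

* Position spaces are second countable locally compact Borel spaces (as `T^d`, `ℝ^d`), so that
  joint continuity gives joint measurability on `ℝ × Config s d X`.
* The empty level `s = 0` of `bgsrHierarchyFamily` is the constant `1`; it satisfies the
  hierarchy trivially (`C⁰_{0,1} = 0`) and the a priori bound with constant `max R 1`.

## References

* T. Bodineau, I. Gallagher, L. Saint-Raymond, *The Brownian motion as the limit of a
  deterministic system of hard-spheres*, Invent. Math. 203 (2016) 493–553 = arXiv:1305.3397v2:
  §3.3 (3.7)–(3.8), Remark 3.4, Remark 3.5 (p. 10); §4.3 (4.7) (p. 12 of the held text).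
-/

open MeasureTheory Metric Real Set Filter Function
open scoped Nat
open Literature.Analysis.FluidPDE (Config configEnergy GCState freeFlight freeTransport boltzmannHOp
  Geometry)

namespace Literature.MathematicalPhysics.KineticTheory

noncomputable section

section Kinetic

variable {d : Type*} [Fintype d] {X : Type*}

/-! ## From the one-time to the two-time mild hierarchy -/

section TwoTime

variable [MeasurableSpace X]

namespace HierarchyModel

/-- **Restarting Duhamel's formula.** Let the flows of the model `M` form a one-parameter group on
the whole phase space (`Φ_{a+b} = Φ_a ∘ Φ_b` everywhere — true for free flight, false for the
a.e.-defined hard-sphere flows), and let `F` be a family in the Lanford class (`IsNiceT` at every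
level) satisfying the mild hierarchy from time `0`:
`F^{(s)}(t) = S_s(t) F^{(s)}(0) + ∫_0^t S_s(t-τ) C_s F^{(s+1)}(τ) dτ` on `[0, T]`. Then `F` is a
two-time mild solution: `F^{(s)}(t'+h) = S_s(h) F^{(s)}(t') + ∫_0^h S_s(h-τ) C_s F^{(s+1)}(t'+τ) dτ`
(`S_s(h) S_s(t'-τ) = S_s(t'+h-τ)`, then `∫_0^{t'} + ∫_{t'}^{t'+h} = ∫_0^{t'+h}` for the interval
integrable Duhamel integrand of N4a). This is the form of the hierarchies used in BGSR §4.3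
("iterating Duhamel's formula up to time `t - h` instead of time `0`").
[cite: BodineauGallagherSaintRaymondInvent2016, §4.3, p. 12] -/
theorem isMildSolution_of_duhamel_zero (M : HierarchyModel d X)
    (hflow : ∀ (s : ℕ) (a b : ℝ) (Z : Config s d X), M.flow s (a + b) Z = M.flow s a (M.flow s b Z))
    {T : ℝ} {F : (s : ℕ) → ℝ → Config s d X → ℝ} (hnice : ∀ s, IsNiceT T (F s))
    (hduh : ∀ (s : ℕ), ∀ t ∈ Icc 0 T, ∀ Z : Config s d X,
      F s t Z = M.transport s t (F s 0) Z +
        ∫ τ in (0 : ℝ)..t, M.transport s (t - τ) (M.op s (F (s + 1) τ)) Z) :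
    M.IsMildSolution T F where
  niceT := hnice
  mild := by
    intro s t' h ht' hh hT Z
    have ht'h : t' + h ∈ Icc 0 T := ⟨by linarith, hT⟩
    have ht'I : t' ∈ Icc 0 T := ⟨ht', by linarith⟩
    -- the Duhamel integrand at final time `t' + h` is interval integrable on `[0, t' + h]`
    have hIint : IntervalIntegrable (fun τ => M.transport s (t' + h - τ) (M.op s (F (s + 1) τ)) Z)
        volume 0 (t' + h) := intervalIntegrable_duhamelStep M (hnice (s + 1)) ht'h Z
    have hI1 : IntervalIntegrable (fun τ => M.transport s (t' + h - τ) (M.op s (F (s + 1) τ)) Z)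
        volume 0 t' :=
      hIint.mono_set (by
        rw [uIcc_of_le ht', uIcc_of_le (by linarith)]
        exact Icc_subset_Icc le_rfl (by linarith))
    have hI2 : IntervalIntegrable (fun τ => M.transport s (t' + h - τ) (M.op s (F (s + 1) τ)) Z)
        volume t' (t' + h) :=
      hIint.mono_set (by
        rw [uIcc_of_le (by linarith : t' ≤ t' + h), uIcc_of_le (by linarith)]
        exact Icc_subset_Icc ht' le_rfl)
    -- `S_s(h) F^{(s)}(t')`: Duhamel from `0` at time `t'`, transported (group law)
    have hA : M.transport s h (F s t') Z = F s 0 (M.flow s (-(t' + h)) Z) +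
        ∫ τ in (0 : ℝ)..t', M.transport s (t' + h - τ) (M.op s (F (s + 1) τ)) Z := by
      rw [M.transport_apply, hduh s t' ht'I (M.flow s (-h) Z)]
      congr 1
      · rw [M.transport_apply, ← hflow, show -t' + -h = -(t' + h) by ring]
      · refine intervalIntegral.integral_congr fun τ _ => ?_
        simp only [M.transport_apply]
        rw [← hflow]
        congr 1
        ring
    -- the new collisions: shift the time variable by `t'`
    have hB : ∫ τ in (0 : ℝ)..h, M.transport s (h - τ) (M.op s (F (s + 1) (t' + τ))) Z =
        ∫ τ in t'..t' + h, M.transport s (t' + h - τ) (M.op s (F (s + 1) τ)) Z := by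
      have heq : (fun τ => M.transport s (h - τ) (M.op s (F (s + 1) (t' + τ))) Z) =
          fun τ => (fun σ => M.transport s (t' + h - σ) (M.op s (F (s + 1) σ)) Z) (t' + τ) := by
        funext τ
        simp only [M.transport_apply]
        congr 2
        ring
      rw [heq, intervalIntegral.integral_comp_add_left
        (fun σ => M.transport s (t' + h - σ) (M.op s (F (s + 1) σ)) Z) t', add_zero]
    -- Duhamel from `0` at time `t' + h`
    have hL : F s (t' + h) Z = F s 0 (M.flow s (-(t' + h)) Z) +
        ∫ τ in (0 : ℝ)..(t' + h), M.transport s (t' + h - τ) (M.op s (F (s + 1) τ)) Z := by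
      rw [hduh s (t' + h) ht'h Z, M.transport_apply]
    rw [hL, hA, hB, add_assoc, intervalIntegral.integral_add_adjacent_intervals hI1 hI2]

end HierarchyModel

end TwoTime

/-! ## The Boltzmann family `g_α = φ_α ⊗ M_β^{⊗s}`: Lanford class and a priori bound (4.7) -/

section BoltzmannFamily

variable [TopologicalSpace X] [MeasurableSpace X] [BorelSpace X] [SecondCountableTopology X]
  [LocallyCompactSpace X] {G : Geometry d X} {β α : ℝ} {f₀ : X → EuclideanSpace ℝ d → ℝ} {R : ℝ}

omit [TopologicalSpace X] [MeasurableSpace X] [BorelSpace X] [SecondCountableTopology X]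
  [LocallyCompactSpace X] in
/-- The empty configuration has zero kinetic energy. [folklore] -/
@[simp]
theorem configEnergy_fin_zero (Z : Config 0 d X) : configEnergy Z = 0 := by
  simp [Literature.Analysis.FluidPDE.configEnergy]

/-- The Maxwellian normalisation constant `(β/2π)^{d/2} = (2π/β)^{-d/2}` of `tensorPow_maxwellianBeta`. [folklore] -/
abbrev maxwellianConst (d : Type*) [Fintype d] (β : ℝ) : ℝ :=
  (2 * Real.pi * β⁻¹) ^ (-(Module.finrank ℝ (EuclideanSpace ℝ d) : ℝ) / 2)

omit [TopologicalSpace X] [MeasurableSpace X] [BorelSpace X] [SecondCountableTopology X]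
  [LocallyCompactSpace X] in
/-- `(β/2π)^{d/2} > 0` for `β > 0`. [folklore] -/
theorem maxwellianConst_pos {β : ℝ} (hβ : 0 < β) : 0 < maxwellianConst d β := by
  unfold maxwellianConst
  exact Real.rpow_pos_of_pos (by positivity) _

namespace LinearBoltzmannData

variable (h : LinearBoltzmannData G β α f₀ R)
include h

omit [MeasurableSpace X] [BorelSpace X] in
/-- **The a priori bound (4.7) for the Boltzmann family**: for every level `k`, time `t` and
configuration, `|g_α^{(k)}(t, Z_k)| ≤ max R 1 · ((β/2π)^{d/2})^k e^{-β H_k(Z_k)}` — the maximum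
principle `0 ≤ φ_α ≤ R` (BGSR Remark 3.5, `linearBoltzmannSeries_mem`) and
`M_β^{⊗k}(V_k) = (β/2π)^{kd/2} e^{-β H_k}`; the `max R 1` only serves the empty level `k = 0`
(value `1`). Printed: `‖g_α^{(k)}(t)‖_{0,k,β} ≤ (β/2π)^{kd/2} ‖ρ⁰‖_{L^∞}`.
[cite: BodineauGallagherSaintRaymondInvent2016, §4.3 (4.7), p. 12] -/
theorem abs_bgsrHierarchyFamily_le (k : ℕ) (t : ℝ) (Z : Config k d X) :
    |bgsrHierarchyFamily β (linearBoltzmannSeries G β α f₀) k t Z| ≤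
      max R 1 * maxwellianConst d β ^ k * exp (-β * configEnergy Z) := by
  cases k with
  | zero => simp [bgsrHierarchyFamily]
  | succ k =>
    rw [bgsrHierarchyFamily_succ, abs_mul, maxwellianTensor, tensorPow_maxwellianBeta]
    have hφ := h.abs_linearBoltzmannSeries_le t (Z 0).1 (Z 0).2
    have hc : 0 < maxwellianConst d β := maxwellianConst_pos h.beta_pos
    have hM : 0 ≤ maxwellianConst d β ^ (k + 1) * exp (-β * configEnergy Z) := by positivity
    rw [abs_of_nonneg hM]
    calc |linearBoltzmannSeries G β α f₀ t (Z 0).1 (Z 0).2| * (maxwellianConst d β ^ (k + 1) * exp (-β * configEnergy Z))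
        ≤ R * (maxwellianConst d β ^ (k + 1) * exp (-β * configEnergy Z)) := mul_le_mul_of_nonneg_right hφ hM
      _ ≤ max R 1 * (maxwellianConst d β ^ (k + 1) * exp (-β * configEnergy Z)) :=
          mul_le_mul_of_nonneg_right (le_max_left _ _) hM
      _ = _ := by ring

/-- The Boltzmann family is jointly measurable in `(t, Z)` at every level (joint continuity of
`φ_α`, `continuous_linearBoltzmannSeries`, on a second countable Borel position space). [folklore] -/
theorem measurable_bgsrHierarchyFamily (k : ℕ) :
    Measurable fun p : ℝ × Config k d X => bgsrHierarchyFamily β (linearBoltzmannSeries G β α f₀) k p.1 p.2 := by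
  cases k with
  | zero => exact measurable_const
  | succ k =>
    simp only [bgsrHierarchyFamily_succ]
    have hφ : Measurable fun p : ℝ × Config (k + 1) d X =>
        linearBoltzmannSeries G β α f₀ p.1 (p.2 0).1 (p.2 0).2 := by
      have hc := h.continuous_linearBoltzmannSeries.measurable
      have hmap : Measurable fun p : ℝ × Config (k + 1) d X => (p.1, (p.2 0).1, (p.2 0).2) :=
        measurable_fst.prodMk (((measurable_pi_apply 0).comp measurable_snd).fst.prodMk
          ((measurable_pi_apply 0).comp measurable_snd).snd)
      exact hc.comp hmap
    have hM : Measurable fun p : ℝ × Config (k + 1) d X => maxwellianTensor β (k + 1) p.2 := by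
      have : (fun p : ℝ × Config (k + 1) d X => maxwellianTensor β (k + 1) p.2) =
          fun p => maxwellianConst d β ^ (k + 1) * exp (-β * configEnergy p.2) := by
        funext p
        exact tensorPow_maxwellianBeta β p.2
      rw [this]
      exact measurable_const.mul ((measurable_const.mul ((measurable_configEnergy' (k + 1)).comp measurable_snd)).exp)
    exact hφ.mul hM

/-- The Boltzmann family is in the Lanford class `IsNiceT` on every `[0, T]`, with the Gaussian
rate `β` (a priori bound (4.7)). [cite: BodineauGallagherSaintRaymondInvent2016, §4.3 (4.7), p. 12] -/
theorem isNiceT_bgsrHierarchyFamily (T : ℝ) (k : ℕ) :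
    IsNiceT T (bgsrHierarchyFamily β (linearBoltzmannSeries G β α f₀) k) where
  measurable := h.measurable_bgsrHierarchyFamily k
  bound := ⟨max R 1 * maxwellianConst d β ^ k, β, h.beta_pos, fun t _ Z => h.abs_bgsrHierarchyFamily_le k t Z⟩

/-- **BGSR Remark 3.4, two-time form: `g_α = φ_α ⊗ M_β^{⊗s}` is a two-time mild solution of the
Boltzmann hierarchy with rate `α`** (`boltzmannModel G hG α` of N4a: free flight and
`C_s = α C⁰_{s,s+1}`) on every `[0, T]`: the one-time Duhamel form from `0`
(`bgsrHierarchyFamily_duhamel`, with the empty level `s = 0` trivial since `C⁰_{0,1} = 0`) is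
restarted at intermediate times by `HierarchyModel.isMildSolution_of_duhamel_zero` (free flight is
a group, `freeFlight_add`). [cite: BodineauGallagherSaintRaymondInvent2016, Remark 3.4 with (3.7), p. 10] -/
theorem isMildSolution_bgsrHierarchyFamily
    (hG : Measurable fun p : X × EuclideanSpace ℝ d => G.translate p.1 p.2) (T : ℝ) :
    (boltzmannModel G hG α).IsMildSolution T (bgsrHierarchyFamily β (linearBoltzmannSeries G β α f₀)) := by
  refine (boltzmannModel G hG α).isMildSolution_of_duhamel_zero ?_ (h.isNiceT_bgsrHierarchyFamily T) ?_
  · intro s a b Z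
    rw [boltzmannModel_flow]
    exact Literature.Analysis.FluidPDE.freeFlight_add G a b Z
  · intro s t ht Z
    cases s with
    | zero =>
      simp [bgsrHierarchyFamily, HierarchyModel.transport_apply, boltzmannModel_op,
        Literature.Analysis.FluidPDE.boltzmannHOp]
    | succ k =>
      have main := h.bgsrHierarchyFamily_duhamel k ht.1 Z
      rw [main, boltzmannModel_transport]
      congr 1
      rw [← intervalIntegral.integral_const_mul]
      refine intervalIntegral.integral_congr fun τ _ => ?_
      simp only [Literature.Analysis.FluidPDE.freeTransport_apply, boltzmannModel_op]

/-- **BGSR Proposition 4.3 for the Boltzmann hierarchy: the remainder `R_α^{0,K}` is `O(γ^A)`.**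
For thresholds `n_k = A^k` (`A ≥ 2`), `0 ≤ γ ≤ 1/2`, `K` blocks of duration `h ≥ 0` and a step with
`max(1, (β/2π)^{d/2}) · c_R · h ≤ γ/e²` (`c_R = pruneConst (boltzmannModel G hG α) β`, proportional
to `|α|`), the first level of the Boltzmann family at time `t = Kh` differs from the main term
`g_α^{(1,K)}(t) = (blockComp K [g_α(0)])^{(1)}` of the pruned expansion (4.11)–(4.12) by at most
`2 γ^A max(R, 1) max(1, (β/2π)^{d/2})` (printed: `‖R_α^{0,K}(t)‖_∞ ≤ C γ^A ‖ρ⁰‖_∞` under (4.13); the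
comparison of the step conditions is in `HierarchyPruningEstimates`). This is N4b's abstract
Proposition 4.3 (`HierarchyModel.IsMildSolution.abs_sub_blockComp_le`) fed with
`isMildSolution_bgsrHierarchyFamily` and the a priori bound (4.7) (`abs_bgsrHierarchyFamily_le`).
[cite: BodineauGallagherSaintRaymondInvent2016, §4.4 Prop. 4.3 (4.14), p. 13] -/
theorem abs_bgsrHierarchyFamily_sub_blockComp_le
    (hG : Measurable fun p : X × EuclideanSpace ℝ d => G.translate p.1 p.2) {A : ℕ} (hA : 2 ≤ A)
    {γ : ℝ} (hγ0 : 0 ≤ γ) (hγ : γ ≤ 1 / 2) {h' : ℝ} (hh0 : 0 ≤ h')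
    (hsmall : max 1 (maxwellianConst d β) * (boltzmannModel G hG α).pruneConst β * h' ≤ γ / exp 2)
    (K : ℕ) (Z : Config 1 d X) :
    |bgsrHierarchyFamily β (linearBoltzmannSeries G β α f₀) 1 (K * h') Z -
        (boltzmannModel G hG α).blockComp (pruneSeq A) h' K
          (fun a => bgsrHierarchyFamily β (linearBoltzmannSeries G β α f₀) a 0) 1 Z| ≤
      2 * γ ^ A * max R 1 * max 1 (maxwellianConst d β) := by
  have hβ := h.beta_pos
  have hmc : 0 < maxwellianConst d β := maxwellianConst_pos hβ
  refine (h.isMildSolution_bgsrHierarchyFamily hG (K * h')).abs_sub_blockComp_le _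
    (le_max_of_le_right zero_le_one) (le_max_left _ _) hβ (fun k τ _ W => ?_) hA hγ0 hγ hh0 hsmall K le_rfl Z
  refine (h.abs_bgsrHierarchyFamily_le k τ W).trans ?_
  have h0 : 0 ≤ max R 1 := le_max_of_le_right zero_le_one
  gcongr
  exact le_max_right _ _

end LinearBoltzmannData

end BoltzmannFamily

/-! ### On the torus -/

section Torus

local notation "𝕋" => UnitAddTorus d

/-- The translation map of the torus geometry is measurable. [folklore] -/
theorem measurable_translate_torus :
    Measurable fun p : 𝕋 × EuclideanSpace ℝ d => (Literature.Analysis.FluidPDE.Torus.geometry d).translate p.1 p.2 := by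
  change Measurable fun p : 𝕋 × EuclideanSpace ℝ d => p.1 + Literature.Analysis.FunctionSpaces.Torus.proj p.2
  exact measurable_fst.add (Literature.Analysis.FunctionSpaces.Torus.measurable_proj.comp measurable_snd)

/-- **BGSR Remark 3.4 with the a priori bound (4.7), in the paper's setting.** On `T^d`, for
`β > 0`, `α ≥ 0` and a continuous datum `0 ≤ ρ⁰ ≤ R`, the family `g_α^{(s)} = φ_α ⊗ M_β^{⊗s}`
built on the solution `φ_α` of (1.3) with datum `ρ⁰` is a two-time mild solution of the Boltzmann
hierarchy with rate `α` on every `[0, T]`, and `|g_α^{(k)}(t, Z_k)| ≤ max R 1 ((β/2π)^{d/2})^k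
e^{-β H_k(Z_k)}` for all `k, t, Z_k`. [cite: BodineauGallagherSaintRaymondInvent2016, Remark 3.4 and §4.3 (4.7)] -/
theorem isMildSolution_bgsrHierarchyFamily_torus {β α : ℝ} (hβ : 0 < β) (hα : 0 ≤ α)
    {ρ₀ : 𝕋 → ℝ} (hρ₀ : Continuous ρ₀) (hρ₀0 : ∀ x, 0 ≤ ρ₀ x) {R : ℝ} (hR : ∀ x, ρ₀ x ≤ R)
    (T : ℝ) :
    (boltzmannModel (Literature.Analysis.FluidPDE.Torus.geometry d) measurable_translate_torus α).IsMildSolution T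
        (bgsrHierarchyFamily β
          (linearBoltzmannSeries (Literature.Analysis.FluidPDE.Torus.geometry d) β α fun x _ => ρ₀ x)) ∧
      ∀ (k : ℕ) (t : ℝ) (Z : Config k d 𝕋),
        |bgsrHierarchyFamily β
            (linearBoltzmannSeries (Literature.Analysis.FluidPDE.Torus.geometry d) β α fun x _ => ρ₀ x) k t Z| ≤
          max R 1 * maxwellianConst d β ^ k * exp (-β * configEnergy Z) :=
  ⟨(linearBoltzmannData_torus hβ hα hρ₀ hρ₀0 hR).isMildSolution_bgsrHierarchyFamily _ T,
    (linearBoltzmannData_torus hβ hα hρ₀ hρ₀0 hR).abs_bgsrHierarchyFamily_le⟩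

/-- **BGSR Proposition 4.3 for `R_α^{0,K}` in the paper's setting** (`T^d`, datum `ρ⁰(x)`,
`β > 0`, `α ≥ 0`, continuous `0 ≤ ρ⁰ ≤ R`): with `n_k = A^k`, `0 ≤ γ ≤ 1/2` and a step `h ≥ 0`
with `max(1,(β/2π)^{d/2}) c_R h ≤ γ/e²`,
`|g_α^{(1)}(Kh)(z) - g_α^{(1,K)}(Kh)(z)| ≤ 2 γ^A max(R,1) max(1,(β/2π)^{d/2})` for every `z`.
[cite: BodineauGallagherSaintRaymondInvent2016, §4.4 Prop. 4.3 (4.14), p. 13] -/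
theorem abs_bgsrHierarchyFamily_sub_blockComp_le_torus {β α : ℝ} (hβ : 0 < β) (hα : 0 ≤ α)
    {ρ₀ : 𝕋 → ℝ} (hρ₀ : Continuous ρ₀) (hρ₀0 : ∀ x, 0 ≤ ρ₀ x) {R : ℝ} (hR : ∀ x, ρ₀ x ≤ R)
    {A : ℕ} (hA : 2 ≤ A) {γ : ℝ} (hγ0 : 0 ≤ γ) (hγ : γ ≤ 1 / 2) {h : ℝ} (hh0 : 0 ≤ h)
    (hsmall : max 1 (maxwellianConst d β) *
      (boltzmannModel (Literature.Analysis.FluidPDE.Torus.geometry d) measurable_translate_torus α).pruneConst β *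
        h ≤ γ / exp 2)
    (K : ℕ) (Z : Config 1 d 𝕋) :
    |bgsrHierarchyFamily β
          (linearBoltzmannSeries (Literature.Analysis.FluidPDE.Torus.geometry d) β α fun x _ => ρ₀ x) 1 (K * h) Z -
        (boltzmannModel (Literature.Analysis.FluidPDE.Torus.geometry d) measurable_translate_torus α).blockComp
          (pruneSeq A) h K
          (fun a => bgsrHierarchyFamily β
            (linearBoltzmannSeries (Literature.Analysis.FluidPDE.Torus.geometry d) β α fun x _ => ρ₀ x) a 0)
          1 Z| ≤
      2 * γ ^ A * max R 1 * max 1 (maxwellianConst d β) :=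
  (linearBoltzmannData_torus hβ hα hρ₀ hρ₀0 hR).abs_bgsrHierarchyFamily_sub_blockComp_le _ hA hγ0 hγ
    hh0 hsmall K Z

end Torus

end Kinetic

end

end Literature.MathematicalPhysics.KineticTheory
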